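import Summits.CriticalPhenomena.CardyFormulaZ2.Theses.CardyComplexCone
import Literature.Probability.LatticeModels.MedialInterfaceProofs

/-!
# Disproof work file — crux `CoherentMorera` (stmt-CriticalPhenomena-11388, route `CardyComplexCone`, rank 4)

cdisprove unit, generation 3 (refuter `refuter-cdisprove-stmt-CriticalPhenomena-11388-g3-0`).
`lean check`: rc 0, 0 sorry.  Prose lives in docstrings only.

**Access note.** The generation-2 work file (82 KB; its §(j) proved the corner→vertex TRACE
IDENTITY `2cos(π/12)·F_δ(z) = Σ_{c∼z} E_δ(c)` pathwise in Lean, §(k) the q = 1 splice/excise weight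
table) is attached to the item as evidence (`run/gate/evidence/…/20260815T231917Z-Disproof.lean`)
but that store is not mounted on refuter seats and no crux workfile `Disproof.lean` existed, so —
exactly as gen-2 could not read gen-1 — this file is RE-DERIVED and EXTENDED, and is now published
as the crux workfile (`ledger crux cat stmt-CriticalPhenomena-11388 Disproof.lean`).  What gen-1/2
established and this file relies on only through docstrings: (g1) the logical shape (§A below,
re-proved); (g1, g2, ideators 1 and 3, kit j005379 / j006260 / j005085 / j004835) the CHIRALITY of the
Duminil-Copin 2012 Prop. 4 relation for the tree's corner observable is `χ = +i` in clockwise compass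
labels, exact in `ℤ[ζ₂₄]` on four admissible rectangles and pairwise (`ω ↔ ω ∪ {e}`) on 131 084
pairs — in the language of §B below: the percolation corner observable satisfies `KirchhoffAt` at
every free medial vertex; (g2) the trace identity, exact off `{e_a, e_b}`; (ideator 1) exact
quarter-turn covariance `E^{iD,iΛ}(Rv, Rf − e₀) = E^{D,Λ}(v, f)` on 40 corners.

## Findings of generation 3 (this file)

* §A `not_coherentMorera_iff` : `¬ CoherentMorera ↔ EdgeCoherence ∧ EdgePrecompact ∧ ¬ Conclusion`.
  Both antecedents are open statements about critical bond percolation (EdgeCoherence = DCS 2012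
  Conj. 8.7 read projectively; grounder g20-17), and `Conclusion` (family-form weak holomorphy +
  precompactness of `δ^{-1/3}F_δ`) is itself conjecturally TRUE for every discretisation family
  (its three clauses only involve local two-arm / winding-phase quantities, uniformly in the arcs).
  A kill therefore needs a JUNK reason making the antecedents provable; the audit of
  `DobrushinDomain` (= `MarkedDomain 2`, genuine Jordan domain), `DiscreteDobrushin` families
  (arcs arbitrary but cut out of `zdBoundary`, hence within `δ` of `∂D`; certified admissible
  family of the unit disc `UnitDiscDiscretisation.discData` in tree ⇒ the family forms are NOT
  vacuous), `medialExploration` (= the cut orbit, `existsUnique_medialExploration_holds`),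
  `passageSum`/`windingAt` (spin argument `(1/3 : ℝ)`, no ℕ-division junk) and the `∑ᶠ` (finite:
  `passageSum` vanishes off lattice edges, `∂̄φ` off `tsupport φ`) found none.  VERDICT: resists —
  structurally unfalsifiable short of proving Conj. 8.7-type statements.
* §B–§C (new, exact lattice algebra, the frame in which the intended proof lives): corner fields
  `E : Site 2 → Fin 4 → ℂ` on the corners `(v, faceAt v k)` of `MedialInterfaceProofs`; the DC12
  relation in flux form `KirchhoffAt` (⟺ `HalfCRRelationAt I` of the barrier file in both
  orientations: `kirchhoffAt_zero_iff`, `kirchhoffAt_one_iff`); POTENTIAL FIELDS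
  `E(v,k) = i^{-k}(H_F(faceAt v k) − H_S(v))` satisfy it identically (`kirchhoffAt_potentialField`) —
  they are the general solution on simply connected regions (div-free flow = co-gradient) — and the
  ℤ₄-FOURIER MODES `A_j = Σ_k i^{-jk} E(v,k)` (the spin-`(1+3j)/3` site observables) of a potential
  field are: `A₀ = ∂_d H_F` (discrete ∂ around `v`), `A₂ = ∂̄_d H_F`, `A₁ =` mixed second difference
  of `H_F`, `A₃ = Σ_faces H_F − 4 H_S` (`A0_potentialField` … `A3_potentialField`).  Consequences for
  the crux: weak holomorphy of the spin-1/3 vertex observable (`≈ (cos π/12)⁻¹·2A₀` by the trace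
  identity) ⟺ `A₂ = o(δ^{1/3})` weakly (the staggered identity of card `staggered-green-transfer` is
  `A₀`-pairing `= i·A₂`-pairing, automatic for potentials); the leading-order content of Kirchhoff at
  one vertex is `A₁ = o(δ^{1/3})` (so the character `χ₁ = (1,i,−1,−i)` can only be carried by a
  DEGENERATE observable); `A₃` is unconstrained by Kirchhoff (it is the only mode seen at `|A₃|/|A₀| ≈
  0.4–0.5` on small boxes, ideator 3; its decay `∼ L^{-1/4}` is what kit j007119 measures).
* §D `character_single_mode`: for a ℤ₄-character `u` (the only universal class vectors compatible
  with quarter-turn covariance, card `z4-trace-character-collapse`) all pairwise products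
  `Â_j(u)·Â_{j'}(u)`, `j ≠ j'`, vanish: exactly one mode is charged.  Hence under EdgeCoherence with a
  character: `χ₀ ⇒ A₂, A₃, A₁ = o(δ^{1/3}) ⇒` weak holomorphy; `χ₂, χ₃ ⇒ A₀ = o ⇒ F_δ = o(δ^{1/3})`
  (conclusion trivially); `χ₁` degenerate.  The planner's "wrong character" worry is therefore NOT
  an obstruction: every character case closes, two of them trivially.
* §E **LOAD-BEARING ANALYSIS — character selection (ℤ₄ covariance + universality of `u`) is
  load-bearing; Kirchhoff + EdgePrecompact + coherence with a NON-character vector do NOT give weak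
  holomorphy.**  Explicit abstract family (`modelField μ s`, `s = δ^{1/3}`): the potential field of
  `Φ(x,y) = (x + iμy)²` read at physical positions.  PROVED here, exactly at every mesh:
  Kirchhoff at every medial vertex (`kirchhoffAt_modelField`); closed form
  `E(v,k) = i^{-k} s⁴ (2 a_v c_k + c_k²)`, `a_v = v₀ + iμ v₁` (`modelField_apply`), i.e. `|E| ≍ δ^{1/3}`
  on compacts with smooth profile (EdgePrecompact shape); EXACT projective coherence defect
  `u_{k'}E_k − u_k E_{k'} = s⁴·const` `= O(δ^{4/3}) = o(δ^{1/3})` with the universal EVEN vector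
  `uModel μ = ((1+iμ), (μ+i), (1+iμ), (μ+i))/2` (`coherence_defect`, `uModel_eq`), which is a
  character iff `μ = ±1` (`uModel_one`, `uModel_neg_one`, `uModel_not_character`); modes
  `A₀ = 2(1+μ)(1+i)s⁴a_v`, `A₂ = 2(1−μ)(1−i)s⁴a_v`, `A₁ = 2iμ s⁴`, `A₃ = (1−μ²)s⁴`
  (`A0_modelField` … `A3_modelField`); and the discrete `∂̄` of the spin-1/3 site observable is the
  NON-ZERO constant `2(1+μ)(1−μ)(1+i)s⁴ = c·δ^{4/3}` per site (`dbar_A0_modelField`), so that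
  `δ^{5/3} Σ_z F_δ(z) ∂̄φ(z_δ) → −(cos π/12)⁻¹(1−μ²)(1+i)∫φ ≠ 0` for `μ ∉ {±1}`: the first clause of
  `Conclusion` FAILS in the model although every input of the intended proof except covariance holds.
  `μ = 1` is the discrete image of the conformal case (`A₂ ≡ 0`, `u ∝ (1,1,1,1)`), `μ = −1` the
  anti-conformal one (`A₀ ≡ 0`).  Moral for provers: the proof of `CoherentMorera` must USE the
  rotation covariance of `medialExploration`/`bondPercolation` (to force `u` to be a character when
  the observable is non-degenerate somewhere) — Kirchhoff (DC12 Prop. 4) and the two hypotheses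
  alone are consistent with the anisotropic-holomorphic limits `g(x + iμ' y)`.
* §F (second load-bearing result): the corner TRACE of a lattice edge (whose `(2cos(π/12))⁻¹`
  multiple is the vertex observable, gen-2's trace identity) of ANY potential field is a pure
  discrete gradient, `(1∓i)`·(face potential across the edge) `+ (1±i)`·(site potential along it)
  (`traceH_potentialField`, `traceV_potentialField`); the STAGGERED site potential
  `H_S = (−1)^{v₀+v₁}`, `H_F = 0` gives a Kirchhoff-exact field, EXACTLY coherent with the character
  `−i^{-k}` (`coherence_sitePotential`, `isZ4Character_neg_wtInv`), all corner moduli equal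
  (`norm_sitePotential`), spin-1/3 site observable `A₀ ≡ 0` (`modes_stag`: only `A₃` is charged), yet
  vertex traces on ADJACENT parallel edges differ by `4(1+i)` times the corner size
  (`traceH_stag_jump`) — the planner's "vertex observable staggers between medial sublattices",
  realised exactly; it violates precisely EdgePrecompact (ii), which is therefore load-bearing for
  the second clause of `Conclusion` (clause (i) and coherence do not suffice).  Landed as
  `Theorems/CoherentMorera/Negative/` part 3 (see DisproofLandingPlan.md).
* NUMERICS (this unit; script `compute/modes_scaling.py`, tree conventions = those of corner_enum.py /
  chirality_enum.py; in-session runs, 5×5 central block, arcs A = bottom+left, L = 16/32/64/128/256 with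
  2·10⁵/1.2·10⁵/6·10⁴/8·10⁴/2.4·10⁴ samples — JSON attached to the item as evidence; kit j007358 repeats
  L ≤ 128 with another seed as a certified artifact).  ANTECEDENTS LOOK TRUE WITH THE TRIVIAL CHARACTER:
  `|A₀|·L^{1/3} = 2.873, 2.843, 2.861, 2.826, 2.824` (spin-1/3 site observable scales like `δ^{1/3}`:
  EdgePrecompact (i) shape, exponent `x₂(1/3) = 1/3`);  `Σ_r P_r·L^{1/4} = 3.29, 3.27, 3.29, 3.25, 3.27`
  (passage probability `∼ δ^{1/4}`, two-arm exponent) and `|A₀|/Σ_r P_r = 0.694, 0.651, 0.615, 0.581,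
  0.544 ∝ L^{−1/12}` (the winding-phase cancellation `δ^{1/12}` itself);  `|A₃|/|A₀|·L^{1/4} = 0.646,
  0.637, 0.634, 0.633, 0.640` over four octaves (the only visible non-trivial mode decays like
  `δ^{1/4} = δ^{x₂(2/3) − x₂(1/3)}`);  `|A₁|/|A₀|, |A₂|/|A₀| ≤ 2·10⁻³` (noise level `∼10⁻³`);  class
  ratios `S_r/S₀ → 1`: `S₂/S₀ = 0.512, 0.578, 0.634, 0.683, 0.725`, `S₁/S₀ = 0.76−0.25i, 0.79−0.21i,
  0.82−0.18i, 0.84−0.16i, 0.86−0.13i`, `S₃/S₀ = conj` — the class vector converges (slowly, rate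
  `δ^{1/4}`) to `u = (1,1,1,1) = χ₀`, the conformal character, exactly as EdgeCoherence + covariance
  predict; the coherence defect is `≍ δ^{1/3+1/4}`.  Vertex isotropy `|F_h − F_v|/|F_h| = 5.6, 1.4, 0.9,
  1.7, 1.5 ·10⁻³` (→ noise floor; conclusion (ii) shape); trace identity residual in expectation `0.0`
  (g2's pathwise theorem); mean path length `382, 1307, 4443, 15016, 50650 ∼ L^{7/4}`.  So route kill
  criterion (2) does NOT fire: the four corner classes DO settle to one projective direction, and it
  is the trivial character — the crux is "true for the right reason", its live case being `χ₀` of §D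
  (cross-check: the sibling card `EdgeCoherence/Ideas/spin-aliasing-vertex-mode` reports the same mode
  decaying like `L^{−0.23}`, rattack-11147, L ≤ 256).

## Provability map handed to the provers
`CoherentMorera` ⇐ (1) `KirchhoffAt` for the percolation corner observable at free medial vertices
(DC12 Prop. 4 for the tree's conventions; verified exactly, owed in Lean) + (2) quarter-turn
covariance of `medialExploration` under rotation of `DiscreteDobrushin` data and of `bondPercolation`
(owed in Lean) + (3) the trace identity (proved by gen-2, file to be re-attached by an operator) +
(4) bookkeeping: dichotomy "`δ^{-1/3}E → 0` locally uniformly for every `(D,Λ,K)`" (then `F_δ =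
o(δ^{1/3})` and both clauses are immediate from EdgePrecompact via (3)) versus "non-degenerate along a
sequence somewhere" (then (2) + universality make `u` a character, §D selects the live mode, and for
`χ₀` the tested Kirchhoff identity — summation by parts of §B against `φ`, Taylor to first order,
errors `O(δ^{2/3})` after the `δ^{5/3}` normalisation using only `|E| ≤ 2` — gives clause 1; clause 2
always follows from EdgePrecompact and (3) since every lattice edge carries one corner of each class
at sites within two lattice steps).  No Morera theorem, no subsequential limits are needed for
clause 1 in this organisation.
-/

noncomputable section

open MeasureTheory Filter Topology Complex
open Literature.Probability.LatticeModels Literature.Probability.RandomPlanarGeometry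
open Literature.Probability.Percolation

namespace Summit.CriticalPhenomena.CardyFormulaZ2.Cruxes.CoherentMorera.Disproof

open Summit.CriticalPhenomena.CardyFormulaZ2.Theses.CardyComplexCone
  (EdgeCoherence EdgePrecompact CoherentMorera)

/-! ## §A Logical shape of the crux

(Name-resolution caveat for whoever copies the route text next: this file imports
`MedialInterfaceProofs`, hence `FermionicObservable`; the fully-qualified `…LatticeModels.passageSum`
then denotes FermionicObservable's constant, NOT the alias of `MedialPath.passageSum` that the route
file sees — the verbatim copy below therefore writes `MedialPath.passageSum`, and `coherentMorera_iff`
is `Iff.rfl` only with that spelling.) -/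

/-- First clause of the conclusion: family-form weak holomorphy of the spin-1/3 vertex observable
(verbatim from the route file, `MedialPath.passageSum` spelled out). [folklore] -/
def WeakHolomorphyFamilies : Prop :=
  ∀ (D : Literature.Probability.RandomPlanarGeometry.DobrushinDomain) (Λ : ℝ → Literature.Probability.LatticeModels.DiscreteDobrushin), (∀ δ, (Λ δ).Ω = D.carrier) → (∀ δ, (Λ δ).δ = δ) → (∀ᶠ δ in 𝓝[>] (0:ℝ), (Λ δ).IsZdAdmissible) → ∀ (φ : ℂ → ℂ), ContDiff ℝ (⊤ : ℕ∞) φ → HasCompactSupport φ → tsupport φ ⊆ D.carrier → Tendsto (fun δ : ℝ => ((δ ^ ((5:ℝ) / 3) : ℝ) : ℂ) * ∑ᶠ z : Literature.Probability.LatticeModels.MedialVertex, (∫ ω, Literature.Probability.LatticeModels.MedialPath.passageSum (Literature.Probability.LatticeModels.medialExploration (Λ δ) ω) δ (1 / 3) z ∂(Literature.Probability.Percolation.bondPercolation (Literature.Probability.LatticeModels.zdGraph 2) Literature.Probability.Percolation.half)) * ((fderiv ℝ φ (Literature.Probability.LatticeModels.medialPoint δ z) 1 + Complex.I * fderiv ℝ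 φ (Literature.Probability.LatticeModels.medialPoint δ z) Complex.I) / 2)) (𝓝[>] (0:ℝ)) (𝓝 0)

/-- Second clause of the conclusion: family-form precompactness of `δ^{-1/3} F_δ` on lattice edges
(verbatim from the route file, with the rev-3 edge guards). [folklore] -/
def PrecompactFamilies : Prop :=
  ∀ (D : Literature.Probability.RandomPlanarGeometry.DobrushinDomain) (Λ : ℝ → Literature.Probability.LatticeModels.DiscreteDobrushin), (∀ δ, (Λ δ).Ω = D.carrier) → (∀ δ, (Λ δ).δ = δ) → (∀ᶠ δ in 𝓝[>] (0:ℝ), (Λ δ).IsZdAdmissible) → let F : ℝ → Literature.Probability.LatticeModels.MedialVertex → ℂ := fun δ z => ∫ ω, Literature.Probability.LatticeModels.MedialPath.passageSum (Literature.Probability.LatticeModels.medialExploration (Λ δ) ω) δ (1 / 3) z ∂(Literature.Probability.Percolation.bondPercolation (Literature.Probability.LatticeModels.zdGraph 2) Literature.Probability.Percolation.half); ∀ K : Set ℂ, IsCompact K → K ⊆ D.carrier → (∃ C : ℝ, ∀ᶠ δ in 𝓝[>] (0:ℝ), ∀ z : Literature.Probability.LatticeModels.MedialVertex, z ∈ (Literature.Probability.LatticeModels.zdGraph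 2).edgeSet → Literature.Probability.LatticeModels.medialPoint δ z ∈ K → ‖F δ z‖ ≤ C * δ ^ ((1:ℝ) / 3)) ∧ (∀ ε > (0:ℝ), ∃ η > (0:ℝ), ∀ᶠ δ in 𝓝[>] (0:ℝ), ∀ z z' : Literature.Probability.LatticeModels.MedialVertex, z ∈ (Literature.Probability.LatticeModels.zdGraph 2).edgeSet → z' ∈ (Literature.Probability.LatticeModels.zdGraph 2).edgeSet → Literature.Probability.LatticeModels.medialPoint δ z ∈ K → Literature.Probability.LatticeModels.medialPoint δ z' ∈ K → dist (Literature.Probability.LatticeModels.medialPoint δ z) (Literature.Probability.LatticeModels.medialPoint δ z') < η → ‖F δ z - F δ z'‖ ≤ ε * δ ^ ((1:ℝ) / 3))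

/-- The conclusion of the crux. [folklore] -/
def Conclusion : Prop := WeakHolomorphyFamilies ∧ PrecompactFamilies

/-- The crux is literally `EdgeCoherence → EdgePrecompact → Conclusion`. [folklore] -/
theorem coherentMorera_iff : CoherentMorera ↔ (EdgeCoherence → EdgePrecompact → Conclusion) :=
  Iff.rfl

/-- Propositional skeleton of an implication crux with two hypotheses. [folklore] -/
theorem not_imp_imp_iff {a b c : Prop} : ¬ (a → b → c) ↔ a ∧ b ∧ ¬ c := by
  constructor
  · intro h
    by_contra h'
    exact h fun ha hb => by_contra fun hc => h' ⟨ha, hb, hc⟩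
  · rintro ⟨ha, hb, hc⟩ h
    exact hc (h ha hb)

/-- **One-sidedness.** Refuting the crux means PROVING both open antecedents and refuting the
(conjecturally true) conclusion. [folklore] -/
theorem not_coherentMorera_iff :
    ¬ CoherentMorera ↔ EdgeCoherence ∧ EdgePrecompact ∧ ¬ Conclusion :=
  not_imp_imp_iff

/-- The crux follows from its conclusion alone. [folklore] -/
theorem coherentMorera_of_conclusion (h : Conclusion) : CoherentMorera := fun _ _ => h

/-- The crux holds vacuously if `EdgeCoherence` fails (route kill criterion (2) territory). [folklore] -/
theorem coherentMorera_of_not_edgeCoherence (h : ¬ EdgeCoherence) : CoherentMorera :=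
  fun hc => absurd hc h

/-- The crux holds vacuously if `EdgePrecompact` fails (route kill criterion (4) territory). [folklore] -/
theorem coherentMorera_of_not_edgePrecompact (h : ¬ EdgePrecompact) : CoherentMorera :=
  fun _ hp => absurd hp h

/-! ## §B Corner fields on `ℤ²`, the Kirchhoff (DC12 Prop. 4, `χ = +i`) relation, potentials

A corner field assigns a complex number to every corner `(v, faceAt v k)` (`k : Fin 4`
counter-clockwise, `faceAt v 0 = v`; class `k` ↔ offset `f − v = −cornerOff k ∈
{0, −e₀, −e₀−e₁, −e₁}`, the four classes of the crux, `faceAt_sub`).  The corner `(v,k)` is the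
medial edge from the midpoint of the lattice edge `s(v, v + cornerUnit k)` to that of
`s(v, v + cornerUnit (k+1))` (`cornerSource_faceAt`, `cornerTarget_faceAt`); its travel direction is
`e^{3πi/4}·i^k` (NW, SW, SE, NE for `k = 0, 1, 2, 3`). -/

/-- The weights `i^k` (travel directions with the common factor `e^{3πi/4}` dropped). [folklore] -/
def wt : Fin 4 → ℂ
  | 0 => 1
  | 1 => I
  | 2 => -1
  | 3 => -I

/-- The inverse weights `i^{-k}`. [folklore] -/
def wtInv : Fin 4 → ℂ
  | 0 => 1
  | 1 => -I
  | 2 => -1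
  | 3 => I

/-- `i^0 = 1`. [folklore] -/
@[simp] theorem wt_zero : wt 0 = 1 := rfl
/-- `i^1 = i`. [folklore] -/
@[simp] theorem wt_one : wt 1 = I := rfl
/-- `i^2 = -1`. [folklore] -/
@[simp] theorem wt_two : wt 2 = -1 := rfl
/-- `i^3 = -i`. [folklore] -/
@[simp] theorem wt_three : wt 3 = -I := rfl
/-- `i^0 = 1`. [folklore] -/
@[simp] theorem wtInv_zero : wtInv 0 = 1 := rfl
/-- `i^{-1} = -i`. [folklore] -/
@[simp] theorem wtInv_one : wtInv 1 = -I := rfl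
/-- `i^{-2} = -1`. [folklore] -/
@[simp] theorem wtInv_two : wtInv 2 = -1 := rfl
/-- `i^{-3} = i`. [folklore] -/
@[simp] theorem wtInv_three : wtInv 3 = I := rfl

/-- `i^k · i^{-k} = 1`. [folklore] -/
theorem wt_mul_wtInv (k : Fin 4) : wt k * wtInv k = 1 := by
  fin_cases k
  · simp
  · simp
  · simp
  · simp

/-- **Kirchhoff's law at a medial vertex** — the lattice edge `e = s(v, v + cornerUnit k)`: the
direction-weighted sum over the two corners LEAVING `e`, `(v, k)` and `(v + e_k, k+2)`, equals that
over the two corners ARRIVING at `e`, `(v, k+3)` and `(v + e_k, k+1)`.  This is the flux form of the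
Duminil-Copin 2012 Prop. 4 / DCS 2012 Prop. 8.6 relation with chirality `χ = +i`
(`kirchhoffAt_zero_iff`, `kirchhoffAt_one_iff`), the form in which gen-1/gen-2/ideator-3 certified it
for the percolation corner observable ("divergence-freeness of the flow `E·t`"). [folklore] -/
def KirchhoffAt (E : Site 2 → Fin 4 → ℂ) (v : Site 2) (k : Fin 4) : Prop :=
  wt k * E v k + wt (k + 2) * E (v + cornerUnit k) (k + 2) =
    wt (k + 3) * E v (k + 3) + wt (k + 1) * E (v + cornerUnit k) (k + 1)

/-- **Dictionary, horizontal medial vertex** `s(x, x + e₀)`: in the clockwise compass labels of the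
barrier file (`NW = (x, x)` = class 0 at `x`, `NE = (x+e₀, x)` = class 1 at `x + e₀`,
`SE = (x+e₀, x−e₁)` = class 2 at `x + e₀`, `SW = (x, x−e₁)` = class 3 at `x`) Kirchhoff reads
`E(NW) − E(SE) = i (E(NE) − E(SW))`, i.e. `HalfCRRelationAt I`. [folklore] -/
theorem kirchhoffAt_zero_iff (E : Site 2 → Fin 4 → ℂ) (x : Site 2) :
    KirchhoffAt E x 0 ↔
      E x 0 - E (x + cornerUnit 0) 2 = I * (E (x + cornerUnit 0) 1 - E x 3) := by
  simp only [KirchhoffAt, show (0 : Fin 4) + 1 = 1 from rfl, show (0 : Fin 4) + 2 = 2 from rfl,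
    show (0 : Fin 4) + 3 = 3 from rfl, wt_zero, wt_one, wt_two, wt_three]
  constructor <;> intro h <;> linear_combination h

/-- **Dictionary, vertical medial vertex** `s(x, x + e₁)`: with `NW = (x+e₁, x−e₀)` = class 2 at
`x + e₁`, `NE = (x+e₁, x)` = class 3 at `x + e₁`, `SE = (x, x)` = class 0 at `x`, `SW = (x, x−e₀)` =
class 1 at `x`, Kirchhoff again reads `E(NW) − E(SE) = i (E(NE) − E(SW))` (same chirality at both
orientations, as certified by the enumerations). [folklore] -/
theorem kirchhoffAt_one_iff (E : Site 2 → Fin 4 → ℂ) (x : Site 2) :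
    KirchhoffAt E x 1 ↔
      E (x + cornerUnit 1) 2 - E x 0 = I * (E (x + cornerUnit 1) 3 - E x 1) := by
  simp only [KirchhoffAt, show (1 : Fin 4) + 1 = 2 from rfl, show (1 : Fin 4) + 2 = 3 from rfl,
    show (1 : Fin 4) + 3 = 0 from rfl, wt_zero, wt_one, wt_two, wt_three]
  constructor <;> intro h <;> linear_combination h

/-- **Potential (co-gradient) corner fields**: `E(v,k) = i^{-k}·(H_F(faceAt v k) − H_S(v))` for a
face potential `H_F` and a site potential `H_S`.  (On a simply connected region these are ALL the
Kirchhoff fields: a divergence-free flow on the planar medial graph is the co-gradient of a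
function on its faces, which are the sites and the faces of `ℤ²`; cf. the local kernel element
`faceKernel` of the barrier file = the potential field of the indicator of one face.) [folklore] -/
def potentialField (HS HF : Site 2 → ℂ) : Site 2 → Fin 4 → ℂ :=
  fun v k => wtInv k * (HF (faceAt v k) - HS v)

/-- **Potential fields satisfy Kirchhoff at every medial vertex** (both orientations, every site),
exactly. [folklore] -/
theorem kirchhoffAt_potentialField (HS HF : Site 2 → ℂ) (v : Site 2) (k : Fin 4) :
    KirchhoffAt (potentialField HS HF) v k := by
  unfold KirchhoffAt potentialField
  rw [faceAt_add_unit_add_two, faceAt_add_unit_succ]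
  have h0 := wt_mul_wtInv k
  have h1 := wt_mul_wtInv (k + 1)
  have h2 := wt_mul_wtInv (k + 2)
  have h3 := wt_mul_wtInv (k + 3)
  linear_combination (HF (faceAt v k) - HS v) * h0 +
    (HF (faceAt v (k + 3)) - HS (v + cornerUnit k)) * h2 -
    (HF (faceAt v (k + 3)) - HS v) * h3 - (HF (faceAt v k) - HS (v + cornerUnit k)) * h1

/-! ## §C The `ℤ₄`-Fourier modes of a corner field at a site -/

/-- Mode `A₀ = Σ_k E(v,k)`: the spin-`1/3` SITE observable (sum of the four corner values); by the
trace identity the vertex observable of a lattice edge is `(2cos(π/12))⁻¹` times the sum of one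
corner of each class at its two endpoints. [folklore] -/
def A0 (E : Site 2 → Fin 4 → ℂ) (v : Site 2) : ℂ := E v 0 + E v 1 + E v 2 + E v 3

/-- Mode `A₁ = Σ_k i^{-k} E(v,k)` (spin `4/3`). [folklore] -/
def A1 (E : Site 2 → Fin 4 → ℂ) (v : Site 2) : ℂ := E v 0 - I * E v 1 - E v 2 + I * E v 3

/-- Mode `A₂ = Σ_k (−1)^k E(v,k)` (spin `7/3`; the STAGGERED combination). [folklore] -/
def A2 (E : Site 2 → Fin 4 → ℂ) (v : Site 2) : ℂ := E v 0 - E v 1 + E v 2 - E v 3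

/-- Mode `A₃ = Σ_k i^{k} E(v,k)` (spin `10/3 ≡ −2/3`). [folklore] -/
def A3 (E : Site 2 → Fin 4 → ℂ) (v : Site 2) : ℂ := E v 0 + I * E v 1 - E v 2 - I * E v 3

/-- Fourier inversion, class 0: `4 E(v,0) = A₀ + A₁ + A₂ + A₃`. [folklore] -/
theorem four_mul_corner_zero (E : Site 2 → Fin 4 → ℂ) (v : Site 2) :
    4 * E v 0 = A0 E v + A1 E v + A2 E v + A3 E v := by
  simp only [A0, A1, A2, A3]; ring

/-- Fourier inversion, class 1: `4 E(v,1) = A₀ + i A₁ − A₂ − i A₃`. [folklore] -/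
theorem four_mul_corner_one (E : Site 2 → Fin 4 → ℂ) (v : Site 2) :
    4 * E v 1 = A0 E v + I * A1 E v - A2 E v - I * A3 E v := by
  simp only [A0, A1, A2, A3]; linear_combination (2 * (E v 1 - E v 3)) * Complex.I_sq

/-- Fourier inversion, class 2: `4 E(v,2) = A₀ − A₁ + A₂ − A₃`. [folklore] -/
theorem four_mul_corner_two (E : Site 2 → Fin 4 → ℂ) (v : Site 2) :
    4 * E v 2 = A0 E v - A1 E v + A2 E v - A3 E v := by
  simp only [A0, A1, A2, A3]; ring

/-- Fourier inversion, class 3: `4 E(v,3) = A₀ − i A₁ − A₂ + i A₃`. [folklore] -/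
theorem four_mul_corner_three (E : Site 2 → Fin 4 → ℂ) (v : Site 2) :
    4 * E v 3 = A0 E v - I * A1 E v - A2 E v + I * A3 E v := by
  simp only [A0, A1, A2, A3]; linear_combination (2 * (E v 3 - E v 1)) * Complex.I_sq

/-- `A₀` of a potential field is the discrete `∂`-derivative of the FACE potential around `v`
(weights `i^{-k}` on the four faces counter-clockwise); the site potential drops out. [folklore] -/
theorem A0_potentialField (HS HF : Site 2 → ℂ) (v : Site 2) :
    A0 (potentialField HS HF) v =
      HF (faceAt v 0) - I * HF (faceAt v 1) - HF (faceAt v 2) + I * HF (faceAt v 3) := by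
  simp only [A0, potentialField, wtInv_zero, wtInv_one, wtInv_two, wtInv_three]; ring

/-- `A₁` of a potential field is the mixed second difference of the face potential (hence
`O(δ²·‖H_F‖_{C²})`: the leading-order content of Kirchhoff at one vertex is `A₁ = o(δ^{1/3})`). [folklore] -/
theorem A1_potentialField (HS HF : Site 2 → ℂ) (v : Site 2) :
    A1 (potentialField HS HF) v =
      HF (faceAt v 0) - HF (faceAt v 1) + HF (faceAt v 2) - HF (faceAt v 3) := by
  simp only [A1, potentialField, wtInv_zero, wtInv_one, wtInv_two, wtInv_three]
  linear_combination (HF (faceAt v 1) + HF (faceAt v 3) - 2 * HS v) * Complex.I_sq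

/-- `A₂` of a potential field is the discrete `∂̄`-derivative of the face potential. [folklore] -/
theorem A2_potentialField (HS HF : Site 2 → ℂ) (v : Site 2) :
    A2 (potentialField HS HF) v =
      HF (faceAt v 0) + I * HF (faceAt v 1) - HF (faceAt v 2) - I * HF (faceAt v 3) := by
  simp only [A2, potentialField, wtInv_zero, wtInv_one, wtInv_two, wtInv_three]; ring

/-- `A₃` of a potential field is `Σ_faces H_F − 4 H_S`: the only mode that sees the site potential,
unconstrained by Kirchhoff. [folklore] -/
theorem A3_potentialField (HS HF : Site 2 → ℂ) (v : Site 2) :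
    A3 (potentialField HS HF) v =
      HF (faceAt v 0) + HF (faceAt v 1) + HF (faceAt v 2) + HF (faceAt v 3) - 4 * HS v := by
  simp only [A3, potentialField, wtInv_zero, wtInv_one, wtInv_two, wtInv_three]
  linear_combination (2 * HS v - HF (faceAt v 1) - HF (faceAt v 3)) * Complex.I_sq

/-! ## §D Characters: exactly one live mode -/

/-- `u : Fin 4 → ℂ` is a `ℤ₄`-character vector: `u(k+1) = λ u(k)` with `λ⁴ = 1` (the shape forced on a
universal class vector by quarter-turn covariance, card `z4-trace-character-collapse`). [folklore] -/
def IsZ4Character (u : Fin 4 → ℂ) : Prop := ∃ l : ℂ, l ^ 4 = 1 ∧ ∀ k, u (k + 1) = l * u k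

/-- The modes of a vector `u` are the modes of the constant corner field `(v,k) ↦ u k`. [folklore] -/
def vecField (u : Fin 4 → ℂ) : Site 2 → Fin 4 → ℂ := fun _ k => u k

/-- **A character charges exactly one mode**: all pairwise products of its four modes vanish. [folklore] -/
theorem character_single_mode {u : Fin 4 → ℂ} (h : IsZ4Character u) :
    A0 (vecField u) 0 * A1 (vecField u) 0 = 0 ∧ A0 (vecField u) 0 * A2 (vecField u) 0 = 0 ∧
    A0 (vecField u) 0 * A3 (vecField u) 0 = 0 ∧ A1 (vecField u) 0 * A2 (vecField u) 0 = 0 ∧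
    A1 (vecField u) 0 * A3 (vecField u) 0 = 0 ∧ A2 (vecField u) 0 * A3 (vecField u) 0 = 0 := by
  obtain ⟨l, hl, hu⟩ := h
  have h1 : u 1 = l * u 0 := hu 0
  have h2 : u 2 = l * u 1 := hu 1
  have h3 : u 3 = l * u 2 := hu 2
  simp only [A0, A1, A2, A3, vecField]
  rw [h3, h2, h1]
  refine ⟨?_, ?_, ?_, ?_, ?_, ?_⟩
  · linear_combination (-(u 0) ^ 2 * (1 + l) * (1 - I * l)) * hl
  · linear_combination (-(u 0) ^ 2 * (1 + l ^ 2)) * hl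
  · linear_combination (-(u 0) ^ 2 * (1 + l) * (1 + I * l)) * hl
  · linear_combination (-(u 0) ^ 2 * (1 - l) * (1 - I * l)) * hl
  · linear_combination (-(u 0) ^ 2 * (1 - l ^ 2)) * hl +
      (-(u 0) ^ 2 * l ^ 2 * (1 - l ^ 2) ^ 2) * Complex.I_sq
  · linear_combination (-(u 0) ^ 2 * (1 - l) * (1 + I * l)) * hl

/-- **The conformal character.** A character whose spin-`1/3` mode is non-zero is the TRIVIAL
character (all four corner classes equal at leading order) — the only case in which the first
clause of `Conclusion` is not trivially true. [folklore] -/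
theorem character_const_of_A0_ne_zero {u : Fin 4 → ℂ} (h : IsZ4Character u)
    (h0 : A0 (vecField u) 0 ≠ 0) : ∀ k, u k = u 0 := by
  obtain ⟨l, hl, hu⟩ := h
  have h1 : u 1 = l * u 0 := hu 0
  have h2 : u 2 = l * u 1 := hu 1
  have h3 : u 3 = l * u 2 := hu 2
  have hA : A0 (vecField u) 0 = u 0 * (1 + l + l ^ 2 + l ^ 3) := by
    simp only [A0, vecField]; rw [h3, h2, h1]; ring
  have hl1 : l = 1 := by
    by_contra hne
    apply h0
    rw [hA]
    have hfac : (l - 1) * (1 + l + l ^ 2 + l ^ 3) = 0 := by linear_combination hl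
    rcases mul_eq_zero.1 hfac with h | h
    · exact absurd (sub_eq_zero.1 h) hne
    · rw [h, mul_zero]
  subst hl1
  have e1 : u 1 = u 0 := by rw [h1, one_mul]
  have e2 : u 2 = u 0 := by rw [h2, one_mul, e1]
  have e3 : u 3 = u 0 := by rw [h3, one_mul, e2]
  intro k
  fin_cases k
  · rfl
  · exact e1
  · exact e2
  · exact e3

/-- Dictionary with the crux's class vector `u : Site 2 → ℂ` (indexed by the offset `f − v`): the
offset of the class-`k` corner is `−cornerOff k`. [folklore] -/
theorem faceAt_sub (v : Site 2) (k : Fin 4) : faceAt v k - v = -cornerOff k := by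
  simp [faceAt]

/-! ## §E Character selection is load-bearing: an exactly Kirchhoff, coherent, precompact,
## NON-holomorphic family

Parameters: `μ : ℂ` (anisotropy; think `μ ∈ ℝ`) and `s : ℂ` (think `s = δ^{1/3} > 0`).  The physical
position of the site `v` is `δ·v = s³ v`; the potential is `Φ(x, y) = (x + iμy)²` divided by `s²`,
so that corner values are `≍ s = δ^{1/3}` on compacts. -/

/-- The anisotropic coordinate `a(v) = v₀ + iμ v₁` (so `Φ(δv) = (s³ a v)²`). [folklore] -/
def aniso (μ : ℂ) (v : Site 2) : ℂ := (v 0 : ℂ) + I * μ * (v 1 : ℂ)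

/-- The face-centre offsets of the four classes in the anisotropic coordinate:
`c_k = a(−cornerOff k) + (1 + iμ)/2`. [folklore] -/
def cOff (μ : ℂ) : Fin 4 → ℂ
  | 0 => (1 + I * μ) / 2
  | 1 => (-1 + I * μ) / 2
  | 2 => (-1 - I * μ) / 2
  | 3 => (1 - I * μ) / 2

/-- Class-0 offset `(1 + iμ)/2`. [folklore] -/
@[simp] theorem cOff_zero (μ : ℂ) : cOff μ 0 = (1 + I * μ) / 2 := rfl
/-- Class-1 offset `(-1 + iμ)/2`. [folklore] -/
@[simp] theorem cOff_one (μ : ℂ) : cOff μ 1 = (-1 + I * μ) / 2 := rfl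
/-- Class-2 offset `(-1 - iμ)/2`. [folklore] -/
@[simp] theorem cOff_two (μ : ℂ) : cOff μ 2 = (-1 - I * μ) / 2 := rfl
/-- Class-3 offset `(1 - iμ)/2`. [folklore] -/
@[simp] theorem cOff_three (μ : ℂ) : cOff μ 3 = (1 - I * μ) / 2 := rfl

/-- `a` is additive. [folklore] -/
theorem aniso_add (μ : ℂ) (v w : Site 2) : aniso μ (v + w) = aniso μ v + aniso μ w := by
  simp only [aniso, Pi.add_apply, Int.cast_add]; ring

/-- `a` respects subtraction. [folklore] -/
theorem aniso_sub (μ : ℂ) (v w : Site 2) : aniso μ (v - w) = aniso μ v - aniso μ w := by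
  simp only [aniso, Pi.sub_apply, Int.cast_sub]; ring

/-- `a(e₀) = 1`. [folklore] -/
@[simp] theorem aniso_e0 (μ : ℂ) : aniso μ (Pi.single 0 1) = 1 := by
  simp [aniso]

/-- `a(e₁) = iμ`. [folklore] -/
@[simp] theorem aniso_e1 (μ : ℂ) : aniso μ (Pi.single 1 1) = I * μ := by
  simp [aniso]

/-- `a(cornerOff 0) = a(0) = 0`. [folklore] -/
theorem aniso_cornerOff_zero (μ : ℂ) : aniso μ (cornerOff 0) = 0 := by
  simp [aniso, cornerOff]

/-- `a(cornerOff 1) = a(e₀) = 1`. [folklore] -/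
theorem aniso_cornerOff_one (μ : ℂ) : aniso μ (cornerOff 1) = 1 := by
  simp [aniso, cornerOff]

/-- `a(cornerOff 2) = a(e₀ + e₁) = 1 + iμ`. [folklore] -/
theorem aniso_cornerOff_two (μ : ℂ) : aniso μ (cornerOff 2) = 1 + I * μ := by
  simp [aniso, cornerOff]

/-- `a(cornerOff 3) = a(e₁) = iμ`. [folklore] -/
theorem aniso_cornerOff_three (μ : ℂ) : aniso μ (cornerOff 3) = I * μ := by
  simp [aniso, cornerOff]

/-- The face centre of `faceAt v k` in the anisotropic coordinate is `a v + c_k`. [folklore] -/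
theorem aniso_faceAt (μ : ℂ) (v : Site 2) (k : Fin 4) :
    aniso μ (faceAt v k) + (1 + I * μ) / 2 = aniso μ v + cOff μ k := by
  rw [faceAt, aniso_sub]
  fin_cases k
  · simp only [Fin.zero_eta, Fin.isValue, aniso_cornerOff_zero, cOff_zero]; ring
  · simp only [Fin.mk_one, Fin.isValue, aniso_cornerOff_one, cOff_one]; ring
  · simp only [Fin.reduceFinMk, Fin.isValue, aniso_cornerOff_two, cOff_two]; ring
  · simp only [Fin.reduceFinMk, Fin.isValue, aniso_cornerOff_three, cOff_three]; ring

/-- Site potential of the model: `s⁻² Φ(s³ v) = s⁴ (a v)²`. [folklore] -/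
def modelHS (μ s : ℂ) (v : Site 2) : ℂ := s ^ 4 * aniso μ v ^ 2

/-- Face potential of the model: `Φ` at the face centre. [folklore] -/
def modelHF (μ s : ℂ) (f : Site 2) : ℂ := s ^ 4 * (aniso μ f + (1 + I * μ) / 2) ^ 2

/-- **The model corner field** (potential field of `Φ = (x + iμy)²`). [folklore] -/
def modelField (μ s : ℂ) : Site 2 → Fin 4 → ℂ := potentialField (modelHS μ s) (modelHF μ s)

/-- The model satisfies Kirchhoff (DC12 Prop. 4, `χ = +i`) at EVERY medial vertex, exactly. [folklore] -/
theorem kirchhoffAt_modelField (μ s : ℂ) (v : Site 2) (k : Fin 4) :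
    KirchhoffAt (modelField μ s) v k :=
  kirchhoffAt_potentialField _ _ v k

/-- **Closed form**: `E(v,k) = i^{-k} s⁴ (2 a_v c_k + c_k²)` — size `≍ s·|s³ a_v| = δ^{1/3}|x + iμy|`
with a smooth profile: the shape of `EdgePrecompact` (local bound `C δ^{1/3}`, same-class
equicontinuity) holds in the model. [folklore] -/
theorem modelField_apply (μ s : ℂ) (v : Site 2) (k : Fin 4) :
    modelField μ s v k = wtInv k * (s ^ 4 * (2 * aniso μ v * cOff μ k + cOff μ k ^ 2)) := by
  simp only [modelField, potentialField, modelHF, modelHS, aniso_faceAt]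
  ring

/-- The coherence vector of the model: `u_k = i^{-k} c_k`. [folklore] -/
def uModel (μ : ℂ) (k : Fin 4) : ℂ := wtInv k * cOff μ k

/-- `u₀ = (1 + iμ)/2`. [folklore] -/
theorem uModel_zero (μ : ℂ) : uModel μ 0 = (1 + I * μ) / 2 := by
  simp only [uModel, wtInv_zero, cOff_zero]; ring

/-- `u₁ = (μ + i)/2`. [folklore] -/
theorem uModel_one_eq (μ : ℂ) : uModel μ 1 = (μ + I) / 2 := by
  simp only [uModel, wtInv_one, cOff_one]; linear_combination (-μ / 2) * Complex.I_sq

/-- `u₂ = (1 + iμ)/2`. [folklore] -/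
theorem uModel_two (μ : ℂ) : uModel μ 2 = (1 + I * μ) / 2 := by
  simp only [uModel, wtInv_two, cOff_two]; ring

/-- `u₃ = (μ + i)/2`. [folklore] -/
theorem uModel_three (μ : ℂ) : uModel μ 3 = (μ + I) / 2 := by
  simp only [uModel, wtInv_three, cOff_three]; linear_combination (-μ / 2) * Complex.I_sq

/-- `uModel μ = ((1+iμ), (μ+i), (1+iμ), (μ+i))/2` is an EVEN vector (`u₀ = u₂`, `u₁ = u₃`). [folklore] -/
theorem uModel_even (μ : ℂ) : uModel μ 2 = uModel μ 0 ∧ uModel μ 3 = uModel μ 1 := by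
  rw [uModel_zero, uModel_one_eq, uModel_two, uModel_three]; exact ⟨rfl, rfl⟩

/-- **Exact projective coherence defect**: `u_{k'} E(v,k) − u_k E(v,k') = s⁴ · (constant in v)`,
i.e. `O(δ^{4/3}) = o(δ^{1/3})` uniformly: the shape of `EdgeCoherence` holds in the model with the
universal vector `uModel μ`. [folklore] -/
theorem coherence_defect (μ s : ℂ) (v : Site 2) (k k' : Fin 4) :
    uModel μ k' * modelField μ s v k - uModel μ k * modelField μ s v k' =
      s ^ 4 * (wtInv k * wtInv k' * (cOff μ k * cOff μ k' * (cOff μ k - cOff μ k'))) := by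
  simp only [modelField_apply, uModel]; ring

/-- `μ = 1` (holomorphic potential `z²`): the model vector is the TRIVIAL character direction
`(1+i)/2 · (1,1,1,1)`. [folklore] -/
theorem uModel_one : ∀ k : Fin 4, uModel 1 k = (1 + I) / 2
  | 0 => (uModel_zero 1).trans (by ring)
  | 1 => (uModel_one_eq 1).trans (by ring)
  | 2 => (uModel_two 1).trans (by ring)
  | 3 => (uModel_three 1).trans (by ring)

/-- `μ = −1` (anti-holomorphic potential `z̄²`): the model vector is the character `χ₂` direction
`(1−i)/2 · (1,−1,1,−1)`. [folklore] -/
theorem uModel_neg_one : ∀ k : Fin 4, uModel (-1) k = (1 - I) / 2 * wt k ^ 2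
  | 0 => (uModel_zero (-1)).trans (by rw [wt_zero]; ring)
  | 1 => (uModel_one_eq (-1)).trans (by
      rw [wt_one]; linear_combination (-(1 - I) / 2) * Complex.I_sq)
  | 2 => (uModel_two (-1)).trans (by rw [wt_two]; ring)
  | 3 => (uModel_three (-1)).trans (by
      rw [wt_three]; linear_combination (-(1 - I) / 2) * Complex.I_sq)

/-- **Not a character otherwise**: if `uModel μ` is a `ℤ₄`-character then `μ = 1 ∨ μ = -1`
(so for every other `μ` the model is a coherent Kirchhoff field with a NON-character class
vector). [folklore] -/
theorem uModel_not_character {μ : ℂ} (h : IsZ4Character (uModel μ)) : μ = 1 ∨ μ = -1 := by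
  obtain ⟨l, -, hu⟩ := h
  have e0 : μ + I = l * (1 + I * μ) := by
    have h0 := hu 0
    rw [show (0 : Fin 4) + 1 = 1 from rfl, uModel_one_eq, uModel_zero] at h0
    linear_combination 2 * h0
  have e1 : 1 + I * μ = l * (μ + I) := by
    have h1 := hu 1
    rw [show (1 : Fin 4) + 1 = 2 from rfl, uModel_two, uModel_one_eq] at h1
    linear_combination 2 * h1
  have hl2 : (l ^ 2 - 1) * (μ + I) = 0 := by linear_combination (-1) * e0 + (-l) * e1
  have hμI : μ + I ≠ 0 := by
    intro h0
    have h2 : (1 : ℂ) + I * μ = 0 := by rw [e1, h0, mul_zero]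
    have hμ : μ = -I := by linear_combination h0
    rw [hμ] at h2
    have h3 : (2 : ℂ) = 0 := by linear_combination h2 + Complex.I_sq
    norm_num at h3
  have hl2' : l ^ 2 = 1 := by
    rcases mul_eq_zero.1 hl2 with h | h
    · linear_combination h
    · exact absurd h hμI
  have hl : l = 1 ∨ l = -1 := by
    have hfac : (l - 1) * (l + 1) = 0 := by linear_combination hl2'
    rcases mul_eq_zero.1 hfac with h | h
    · exact Or.inl (by linear_combination h)
    · exact Or.inr (by linear_combination h)
  rcases hl with rfl | rfl
  · left
    have hfac : (μ - 1) * (1 - I) = 0 := by linear_combination e0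
    rcases mul_eq_zero.1 hfac with h | h
    · linear_combination h
    · exfalso
      have := congrArg Complex.re h
      simp at this
  · right
    have hfac : (μ + 1) * (1 + I) = 0 := by linear_combination e0
    rcases mul_eq_zero.1 hfac with h | h
    · linear_combination h
    · exfalso
      have := congrArg Complex.re h
      simp at this

/-- Mode `A₀` of the model: `2(1+μ)(1+i)·s⁴·a_v` — in physical units `2(1+μ)(1+i) δ^{1/3}(x + iμy)`,
non-degenerate for `μ ≠ −1`. [folklore] -/
theorem A0_modelField (μ s : ℂ) (v : Site 2) :
    A0 (modelField μ s) v = s ^ 4 * (2 * (1 + μ) * (1 + I) * aniso μ v) := by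
  simp only [A0, modelField_apply, wtInv_zero, wtInv_one, wtInv_two, wtInv_three, cOff_zero,
    cOff_one, cOff_two, cOff_three]
  linear_combination (-2 * aniso μ v * μ * s ^ 4) * Complex.I_sq

/-- Mode `A₂` of the model: `2(1−μ)(1−i)·s⁴·a_v` — NOT `o(δ^{1/3})` for `μ ≠ 1`: the staggered mode
is alive, so the `A₀`-pairing against `∂̄φ` does not vanish in the limit. [folklore] -/
theorem A2_modelField (μ s : ℂ) (v : Site 2) :
    A2 (modelField μ s) v = s ^ 4 * (2 * (1 - μ) * (1 - I) * aniso μ v) := by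
  simp only [A2, modelField_apply, wtInv_zero, wtInv_one, wtInv_two, wtInv_three, cOff_zero,
    cOff_one, cOff_two, cOff_three]
  linear_combination (2 * aniso μ v * μ * s ^ 4) * Complex.I_sq

/-- Mode `A₁` of the model: the constant `2iμ s⁴ = O(δ^{4/3})`, consistent with the leading-order
content `A₁ = o(δ^{1/3})` of Kirchhoff. [folklore] -/
theorem A1_modelField (μ s : ℂ) (v : Site 2) :
    A1 (modelField μ s) v = s ^ 4 * (2 * I * μ) := by
  simp only [A1, modelField_apply, wtInv_zero, wtInv_one, wtInv_two, wtInv_three, cOff_zero,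
    cOff_one, cOff_two, cOff_three]
  linear_combination (s ^ 4 * (1 - 2 * I * μ + I ^ 2 * μ ^ 2) / 2) * Complex.I_sq

/-- Mode `A₃` of the model: the constant `(1 − μ²) s⁴ = O(δ^{4/3})`. [folklore] -/
theorem A3_modelField (μ s : ℂ) (v : Site 2) :
    A3 (modelField μ s) v = s ^ 4 * (1 - μ ^ 2) := by
  simp only [A3, modelField_apply, wtInv_zero, wtInv_one, wtInv_two, wtInv_three, cOff_zero,
    cOff_one, cOff_two, cOff_three]
  linear_combination (s ^ 4 * (-1 + 2 * I * μ + μ ^ 2 * (2 - I ^ 2)) / 2) * Complex.I_sq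

/-- **Non-holomorphy, exactly**: the discrete `∂̄`-derivative
`A₀(v+e₀) − A₀(v) + i (A₀(v+e₁) − A₀(v))` of the spin-`1/3` site observable of the model is the
non-zero constant `2(1+μ)(1+i)(1−μ)·s⁴` per site (`= c·δ^{4/3}`, `δ^{-2}` sites per unit area,
normalisation `δ^{5/3}·δ^{-1}` from the summation by parts: the tested quantity of the first clause
of `Conclusion` converges to a NON-ZERO multiple of `∫φ` for `μ ∉ {1, −1}`). [folklore] -/
theorem dbar_A0_modelField (μ s : ℂ) (v : Site 2) :
    A0 (modelField μ s) (v + Pi.single 0 1) - A0 (modelField μ s) v +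
        I * (A0 (modelField μ s) (v + Pi.single 1 1) - A0 (modelField μ s) v) =
      s ^ 4 * (2 * (1 + μ) * (1 + I) * (1 - μ)) := by
  rw [A0_modelField, A0_modelField, A0_modelField, aniso_add, aniso_add, aniso_e0, aniso_e1]
  linear_combination (2 * s ^ 4 * (1 + μ) * (1 + I) * μ) * Complex.I_sq

/-- For comparison, the discrete `∂̄` of `A₀` VANISHES identically exactly when `μ = 1` or `μ = −1`
(given `s ≠ 0`): the two character cases of §D. [folklore] -/
theorem dbar_A0_modelField_eq_zero_iff {μ s : ℂ} (hs : s ≠ 0) (v : Site 2) :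
    A0 (modelField μ s) (v + Pi.single 0 1) - A0 (modelField μ s) v +
        I * (A0 (modelField μ s) (v + Pi.single 1 1) - A0 (modelField μ s) v) = 0 ↔
      μ = 1 ∨ μ = -1 := by
  rw [dbar_A0_modelField]
  have h2 : (1 : ℂ) + I ≠ 0 := by
    intro h
    have := congrArg Complex.re h
    simp at this
  have hs4 : s ^ 4 ≠ 0 := pow_ne_zero 4 hs
  constructor
  · intro h
    have h' : (s ^ 4 * (2 * (1 + I))) * ((1 + μ) * (1 - μ)) = 0 := by linear_combination h
    rcases mul_eq_zero.1 h' with h'' | h''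
    · exfalso
      rcases mul_eq_zero.1 h'' with h3 | h3
      · exact hs4 h3
      · exact h2 (by linear_combination h3 / 2)
    · rcases mul_eq_zero.1 h'' with h3 | h3
      · exact Or.inr (by linear_combination h3)
      · exact Or.inl (by linear_combination -h3)
  · rintro (rfl | rfl) <;> ring

/-! ## §F The vertex trace of a Kirchhoff field; the staggered site potential
(EdgePrecompact (ii) is load-bearing for the second clause) -/

/-- The corner trace at the HORIZONTAL lattice edge `s(x, x + e₀)`: the sum of its four corners
(classes `0, 3` at `x`, classes `1, 2` at `x + e₀`).  By the trace identity (gen-2) the spin-`1/3`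
vertex observable of that edge is `(2cos(π/12))⁻¹` times this trace of the corner observable. [folklore] -/
def traceH (E : Site 2 → Fin 4 → ℂ) (x : Site 2) : ℂ :=
  E x 0 + E (x + cornerUnit 0) 1 + E (x + cornerUnit 0) 2 + E x 3

/-- The corner trace at the VERTICAL lattice edge `s(x, x + e₁)` (classes `0, 1` at `x`, classes
`2, 3` at `x + e₁`). [folklore] -/
def traceV (E : Site 2 → Fin 4 → ℂ) (x : Site 2) : ℂ :=
  E x 0 + E x 1 + E (x + cornerUnit 1) 2 + E (x + cornerUnit 1) 3

/-- **The vertex trace of a potential field is a pure discrete GRADIENT**: `(1 − i)`·(face potential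
across the edge) `+ (1 + i)`·(site potential along the edge) — horizontal edges. [folklore] -/
theorem traceH_potentialField (HS HF : Site 2 → ℂ) (x : Site 2) :
    traceH (potentialField HS HF) x =
      (1 - I) * (HF (faceAt x 0) - HF (faceAt x 3)) + (1 + I) * (HS (x + cornerUnit 0) - HS x) := by
  simp only [traceH, potentialField, wtInv_zero, wtInv_one, wtInv_two, wtInv_three]
  rw [show faceAt (x + cornerUnit 0) 1 = faceAt x 0 from faceAt_add_unit_succ x 0,
    show faceAt (x + cornerUnit 0) 2 = faceAt x 3 from faceAt_add_unit_add_two x 0]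
  ring

/-- The same for vertical edges: `(1 + i)`·(face gradient across: `faceAt x 0` right of the edge minus
`faceAt x 1` left of it) `+ (1 − i)`·(site gradient along the edge). [folklore] -/
theorem traceV_potentialField (HS HF : Site 2 → ℂ) (x : Site 2) :
    traceV (potentialField HS HF) x =
      (1 + I) * (HF (faceAt x 0) - HF (faceAt x 1)) + (1 - I) * (HS (x + cornerUnit 1) - HS x) := by
  simp only [traceV, potentialField, wtInv_zero, wtInv_one, wtInv_two, wtInv_three]
  rw [show faceAt (x + cornerUnit 1) 2 = faceAt x 1 from faceAt_add_unit_succ x 1,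
    show faceAt (x + cornerUnit 1) 3 = faceAt x 0 from faceAt_add_unit_add_two x 1]
  ring

/-- The class vector `−i^{-k} = (−1, i, 1, −i)` is a `ℤ₄`-character (ratio `−i`). [folklore] -/
theorem isZ4Character_neg_wtInv : IsZ4Character fun k => -wtInv k := by
  refine ⟨-I, by linear_combination (I ^ 2 - 1) * Complex.I_sq, fun k => ?_⟩
  fin_cases k
  · simp
  · simp
  · simp
  · simp

/-- **A pure site potential is EXACTLY coherent with that character**: `E(v,k) = −i^{-k} H_S(v)`
is rank one at every site, whatever `H_S` is. [folklore] -/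
theorem coherence_sitePotential (HS : Site 2 → ℂ) (v : Site 2) (k k' : Fin 4) :
    (-wtInv k') * potentialField HS 0 v k - (-wtInv k) * potentialField HS 0 v k' = 0 := by
  simp only [potentialField, Pi.zero_apply]; ring

/-- Its corner values have modulus `|H_S(v)|` (so the bound clause (i) of EdgePrecompact is the bound
on `H_S`). [folklore] -/
theorem norm_sitePotential (HS : Site 2 → ℂ) (v : Site 2) (k : Fin 4) :
    ‖potentialField HS 0 v k‖ = ‖HS v‖ := by
  fin_cases k <;> simp [potentialField]

/-- **The staggered site potential** `H_S(v) = (−1)^{v₀+v₁}` (values `±1`). [folklore] -/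
def stagHS (v : Site 2) : ℂ := (((v 0 + v 1).negOnePow : ℤˣ) : ℤ)

/-- Staggering along `e₀`. [folklore] -/
theorem stagHS_add_e0 (v : Site 2) : stagHS (v + cornerUnit 0) = -stagHS v := by
  simp only [stagHS, cornerUnit, Pi.add_apply, Pi.single_eq_same, Pi.single_eq_of_ne one_ne_zero,
    add_zero]
  rw [show v 0 + 1 + v 1 = (v 0 + v 1) + 1 by ring, Int.negOnePow_succ, Units.val_neg, Int.cast_neg]

/-- Staggering along `e₁`. [folklore] -/
theorem stagHS_add_e1 (v : Site 2) : stagHS (v + cornerUnit 1) = -stagHS v := by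
  simp only [stagHS, cornerUnit, Pi.add_apply, Pi.single_eq_same, Pi.single_eq_of_ne zero_ne_one,
    add_zero]
  rw [show v 0 + (v 1 + 1) = (v 0 + v 1) + 1 by ring, Int.negOnePow_succ, Units.val_neg, Int.cast_neg]

/-- The staggered potential never vanishes. [folklore] -/
theorem stagHS_ne_zero (v : Site 2) : stagHS v ≠ 0 := by
  simp only [stagHS, ne_eq, Int.cast_eq_zero]
  exact Units.ne_zero _

/-- **The vertex trace of the staggered model alternates at full size**: at the horizontal edge from
`x` it is `−2(1+i)·H_S(x)` … [folklore] -/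
theorem traceH_stag (x : Site 2) :
    traceH (potentialField stagHS 0) x = -(2 * (1 + I)) * stagHS x := by
  rw [traceH_potentialField, stagHS_add_e0]; simp; ring

/-- … and at the next horizontal edge of the same row it is `+2(1+i)·H_S(x)`. [folklore] -/
theorem traceH_stag_succ (x : Site 2) :
    traceH (potentialField stagHS 0) (x + cornerUnit 0) = (2 * (1 + I)) * stagHS x := by
  rw [traceH_potentialField, stagHS_add_e0, stagHS_add_e0]; simp; ring

/-- **EdgePrecompact (ii) is load-bearing for the second clause.** The staggered site potential gives
a corner field that is Kirchhoff-exact (`kirchhoffAt_potentialField`), EXACTLY coherent with a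
`ℤ₄`-character (`coherence_sitePotential`, `isZ4Character_neg_wtInv`), with all corner moduli
EQUAL to `1` (`norm_sitePotential`; scale it by `δ^{1/3}` for the shape of clause (i)), but whose
vertex traces on two ADJACENT parallel lattice edges differ by `4(1+i) ≠ 0` times the common corner
size — the "vertex observable staggers between medial sublattices" scenario of the planner's
why-might-fail, realised exactly.  It violates precisely the same-class equicontinuity clause (ii)
of EdgePrecompact (same-class values at neighbouring sites differ by twice their size), which is
therefore what excludes it: the second clause of `Conclusion` needs EdgePrecompact (ii), not only
(i) and coherence. [folklore] -/
theorem traceH_stag_jump (x : Site 2) :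
    traceH (potentialField stagHS 0) (x + cornerUnit 0) - traceH (potentialField stagHS 0) x =
      4 * (1 + I) * stagHS x ∧ 4 * (1 + I) * stagHS x ≠ 0 := by
  refine ⟨by rw [traceH_stag_succ, traceH_stag]; ring, ?_⟩
  refine mul_ne_zero (mul_ne_zero (by norm_num) ?_) (stagHS_ne_zero x)
  intro h
  have := congrArg Complex.re h
  simp at this

/-- In mode language: the staggered model is carried entirely by `A₃` (`= −4 H_S`, the free mode of
§C), with `A₀ = A₁ = A₂ = 0` — the spin-`1/3` SITE observable vanishes identically while the
vertex traces do not: site sums and edge traces see different sublattice combinations. [folklore] -/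
theorem modes_stag (v : Site 2) :
    A0 (potentialField stagHS 0) v = 0 ∧ A1 (potentialField stagHS 0) v = 0 ∧
      A2 (potentialField stagHS 0) v = 0 ∧ A3 (potentialField stagHS 0) v = -4 * stagHS v := by
  refine ⟨?_, ?_, ?_, ?_⟩
  · rw [A0_potentialField]; simp
  · rw [A1_potentialField]; simp
  · rw [A2_potentialField]; simp
  · rw [A3_potentialField]; simp

end Summit.CriticalPhenomena.CardyFormulaZ2.Cruxes.CoherentMorera.Disproof

end
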